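/-
Copyright: the b2b-balaban T⁴-continuum CRUX team, row NE7b leaf lineage `t4-ne7b-formalise-leaf-05` (gen 156). Project licence.
-/
import Literature.MathematicalPhysics.QuantumFieldTheory.Balaban1983to89.B7Prop1Explicit
import Summits.QuantumFields.BalabanUV.T4Continuum.Spine.NE7b.NonAbelianStokesBound

/-!
# TWO PATHS WITH THE SAME LETTERS, IN THE UNIT BALL — BY VALUE: `‖V(Γ S) − V(S Γ)‖ ≤ |Γ|·|S|·α` for unit-bounded bond variables with
# `‖V(∂p) − 1‖ ≤ α` on every plaquette, NO smallness condition; hence the block-loop letter `w₁` of `OneStepLoopLetters.delta2_le`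
# (`W₁ = V(Γ_{q,x})·V([x, x+Le_κ])·V(Γ_{q+Le_κ, x+Le_κ})⁻¹·V([q, q+Le_κ])⁻¹`) is `≤ L·l1(x − q)·α ≤ d·L²·α` (row NE7b, node U5c; Lemma CS (ii) of
# `HOME/b2b-balaban-r1/SectE-interface-proof.md` at one step, in [B7]'s currency `𝔸ˣ ∩ U1`)

Cell `pub-balaban`, sub-cell `t4`, spine estimate NE7b (`T4WeightBudget.RelWeightBound`; the cell's OWN estimate — NOT PRINTED in [Bałaban 1983–89],
NOT PROVED).  Crux-route work under `Spine/NE7b/` by a row leaf; [folklore] telescoping in the unit ball of a normed ring; NOTHING of Bałaban's is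
named, asserted or valued; no `T4Continuum/Support` leaf typed; no `def`; zero `sorry`.  Imports the lit-balaban cell's `B7Prop1Explicit`
(`hol`, `stepHol`, `plaqWord`, `lplaqWord`, `seg`, `treeWord`, `l1`, `boxVec`, `U1`, `hol_mem`, `norm_hol_lplaqWord_sub_one_le`,
`norm_units_conj_sub_one_le`, `norm_inv_sub_one_le` BY NAME) and leaf-01's BUILT `NonAbelianStokesBound` (`hol_backtrack`) ONLY — fileable today.

WHY (located).  `OneStepCovariantStokes.norm_coarseCurl_Q0cov_le` (leaf-02, ✓) is Lemma CS (ii) at `k = 1` modulo three loop letters `δ₂, δ₃, δ₄`;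
`OneStepLoopLetters.delta2_le` reduces `δ₂` to `w₁ + ε₁` with `‖W₁ − 1‖ ≤ w₁`, `W₁ = g t₁ g′⁻¹ s₁⁻¹` — the transport «tree contour then segment»
against «segment then translated tree contour»; the by-value junction (leaf-02 g132, OSCSV) takes `w₁ = 64(d+1)(d+4)L²α₀` from `B7Prop2Explicit`'s
exp∕log route, which needs `512(d+1)(d+4)L²α₀ ≤ 1`.  The two words `treeWord r ++ seg κ L` and `seg κ L ++ treeWord r` are PERMUTATIONS of each other;
carrying each of the `l1(r)` contour letters past the `L` segment letters costs one unit square each (none for parallel letters), and in the unit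
ball each square costs `≤ α` IN NORM, with no series: `w₁ ≤ L·l1(r)·α ≤ d·L²·α`, unconditionally.  (The script form of the same device, with the
swept squares located, is this lineage's `NonAbelianStokesTransposition` ∕ `…PathPair` ∕ `…PathPairLocus` in the `GaugeGroup`∕`dist1` currency.)

WHAT IS PROVED ([folklore]; `𝔸` a normed ring with `‖1‖ = 1`, `V : Site → Fin d → 𝔸ˣ` with every `V x κ ∈ U1 𝔸`, `h44 : ‖V(∂p_{κμ}(x)) − 1‖ ≤ α` for
`κ ≠ μ`):
* §1 **`norm_hol_square_sub_one_le`** — EVERY based unit square costs `≤ α`: `‖V(x; l₁ l₂ l₁⁻¹ l₂⁻¹) − 1‖ ≤ α` for letters `l₁ ∦ l₂` of any signs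
  (`lplaqWord` for `l₂ = μ⁺`; the reversed word's inverse for `l₁ = κ⁺, l₂ = μ⁻`; a conjugate of `V(∂p_{κμ}(x − e_κ − e_μ))` for `κ⁻ μ⁻`).
* §2 **`norm_hol_swap_sub_le`** — ONE TRANSPOSITION: `‖V(x; l₁ l₂) − V(x; l₂ l₁)‖ ≤ α` for `l₁ ∦ l₂`, `= 0` for parallel letters
  (`hol_pair_eq_square_mul`: `V(l₁l₂) = V(l₁l₂l₁⁻¹l₂⁻¹)·V(l₂l₁)`, `hol_backtrack`).
* §3 **`norm_hol_cons_sub_append_le`** — carrying ONE letter past a word: `‖V(x; l A) − V(x; A l)‖ ≤ |A|·α` (`0 ≤ α`).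
* §4 **`norm_hol_comm_sub_le`** — carrying a WORD past a word: `‖V(x; Γ S) − V(x; S Γ)‖ ≤ |Γ|·|S|·α`.
* §5 THE CELL'S LETTER: **`norm_hol_treeWord_seg_sub_le`** (`‖V(x; treeWord r · seg κ L) − V(x; seg κ L · treeWord r)‖ ≤ l1(r)·L·α`),
  **`norm_W1_sub_one_le`** (`‖g t₁ g′⁻¹ s₁⁻¹ − 1‖ ≤ l1(r)·L·α` with `g = V(q; treeWord r)`, `t₁ = V(q + r; seg κ L)`, `g′ = V(q + Le_κ; treeWord r)`,
  `s₁ = V(q; seg κ L)` — VERBATIM the `hW` hypothesis of `OneStepLoopLetters.delta2_le`), **`norm_W1_sub_one_le_box`** (`r = boxVec L ρ` ⟹ `≤ d·L²·α`,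
  `l1_boxVec_le`).
* §6 toy: `d`-free sanity of §2 on `a⁺ b⁺`.

NOT HERE (honest): `δ₃, δ₄` (the three- and four-loop letters: the same lemma at the other two corners, composed as in `OneStepLoopLetters` §3–§4 —
left to the consumer), the averaged-bond letter `ε₁` (`B7Eq47AveragedBondVsStraight`), `k > 1`, which `α` print has ((A3) ∕ (A1c), NC-NE7b-α UNRULED).
BY-NAME EFFECT ON THE WALL: NONE ((ℓ1)'s (h1) letter keeps its displayed `(p, q)`).  NE7b NOT PRINTED ∕ NOT PROVED; spine PROVED 0∕9; rung (B)+1 on a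
FINITE torus — NOT infinite volume, NOT the mass gap, NOT Clay.  HONEST DEPENDENCY: continuum YM on T⁴ ⇐ BetaPertH ∧ nine spine estimates (0/9
proved); BetaPertH ⇐ (D1) ∧ (D4) ∧ CAP+tail; G-an2-4 gates asym, D1 and NE2/3/4.
-/

set_option autoImplicit false

noncomputable section

namespace Summit.QuantumFields.BalabanUV.T4Continuum.NE7b.PathPairUnitBall

open Literature.MathematicalPhysics.QuantumFieldTheory.Balaban1983to89.B7Prop1Explicit
open Summit.QuantumFields.BalabanUV.T4Continuum.NE7b.NonAbelianStokesBound (hol_backtrack)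

variable {d : ℕ}
variable {𝔸 : Type*} [NormedRing 𝔸] [NormOneClass 𝔸]
variable {V : Site d → Fin d → 𝔸ˣ} (hV : ∀ x κ, V x κ ∈ U1 𝔸) {α : ℝ}
  (h44 : ∀ (x : Site d) (κ μ : Fin d), κ ≠ μ → ‖((hol V x (plaqWord κ μ) : 𝔸ˣ) : 𝔸) - 1‖ ≤ α)

/-! ## §1 Every based unit square costs `≤ α` -/

section Square

omit [NormOneClass 𝔸] in
/-- The `κ⁻ μ⁻` square based at `x` is a conjugate of the plaquette `∂p_{κμ}(x − e_κ − e_μ)`. [folklore] -/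
theorem hol_square_neg_neg (x : Site d) (κ μ : Fin d) :
    hol V x [((κ, false) : Letter d), (μ, false), (κ, true), (μ, true)] =
      (V (x - e κ - e μ) μ * V (x - e κ) κ)⁻¹ * hol V (x - e κ - e μ) (plaqWord κ μ) * (V (x - e κ - e μ) μ * V (x - e κ) κ) := by
  simp only [plaqWord, hol_cons, hol_nil, mul_one, stepHol_true, stepHol_false, Letter.vec_true, Letter.vec_false, mul_inv_rev]
  abel_nf
  group

include hV h44 in
/-- **EVERY BASED UNIT SQUARE COSTS `≤ α`**: for letters `l₁ = (κ, s)`, `l₂ = (μ, t)` with `κ ≠ μ`, `‖V(x; l₁ l₂ l₁⁻¹ l₂⁻¹) − 1‖ ≤ α`. [folklore] -/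
theorem norm_hol_square_sub_one_le (x : Site d) (l₁ l₂ : Letter d) (h : l₁.1 ≠ l₂.1) :
    ‖((hol V x [l₁, l₂, l₁.rev, l₂.rev] : 𝔸ˣ) : 𝔸) - 1‖ ≤ α := by
  obtain ⟨κ, s⟩ := l₁
  obtain ⟨μ, t⟩ := l₂
  simp only at h
  cases t
  · cases s
    · -- `κ⁻ μ⁻`: conjugate of the plaquette at `x - e κ - e μ`
      simp only [Letter.rev_mk, Bool.not_false]
      rw [hol_square_neg_neg, Units.val_mul, Units.val_mul]
      have hu : V (x - e κ - e μ) μ * V (x - e κ) κ ∈ U1 𝔸 := (U1 𝔸).mul_mem (hV _ _) (hV _ _)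
      exact (norm_units_inv_conj_sub_one_le hu _).trans (h44 _ κ μ h)
    · -- `κ⁺ μ⁻`: the inverse of the `lplaqWord (μ, false) κ` loop
      have hrev : [((κ, true) : Letter d), (μ, false), (κ, false), (μ, true)] = revWord (lplaqWord ((μ, false) : Letter d) κ) := by
        simp [lplaqWord, revWord, Letter.rev]
      simp only [Letter.rev_mk, Bool.not_true, Bool.not_false]
      rw [hrev, hol_revWord' V x _ (by rw [disp_lplaqWord, add_zero])]
      exact (norm_inv_sub_one_le (hol_mem hV _ _)).trans (norm_hol_lplaqWord_sub_one_le V hV h44 x (μ, false) κ (Ne.symm h))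
  · -- `l₂ = μ⁺`: the word IS `lplaqWord l₁ μ`
    exact norm_hol_lplaqWord_sub_one_le V hV h44 x (κ, s) μ h

end Square

/-! ## §2 One transposition -/

section Swap

omit [NormOneClass 𝔸] in
/-- `V(x; l₁ l₂) = V(x; l₁ l₂ l₁⁻¹ l₂⁻¹) · V(x; l₂ l₁)` (two backtracks). [folklore] -/
theorem hol_pair_eq_square_mul (x : Site d) (l₁ l₂ : Letter d) :
    hol V x [l₁, l₂] = hol V x [l₁, l₂, l₁.rev, l₂.rev] * hol V x [l₂, l₁] := by
  have h1 : hol V x [l₁, l₂] = hol V x [l₁, l₂, l₁.rev, l₂.rev, l₂, l₁] := by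
    have hb1 := hol_backtrack V x [l₁, l₂, l₁.rev] [l₁] l₂.rev
    have hb2 := hol_backtrack V x [l₁, l₂] [] l₁.rev
    rw [Letter.rev_rev] at hb1 hb2
    simp only [List.cons_append, List.nil_append, List.append_nil] at hb1 hb2
    rw [hb1, hb2]
  have hd : x + disp [l₁, l₂, l₁.rev, l₂.rev] = x := by
    simp only [disp_cons, disp_nil, Letter.vec_rev, add_zero]; abel
  rw [h1, show [l₁, l₂, l₁.rev, l₂.rev, l₂, l₁] = [l₁, l₂, l₁.rev, l₂.rev] ++ [l₂, l₁] from rfl, hol_append, hd]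

include hV h44 in
/-- **ONE TRANSPOSITION COSTS `≤ α`** (non-parallel letters): `‖V(x; l₁ l₂) − V(x; l₂ l₁)‖ ≤ α`. [folklore] -/
theorem norm_hol_swap_sub_le (x : Site d) (l₁ l₂ : Letter d) (h : l₁.1 ≠ l₂.1) :
    ‖((hol V x [l₁, l₂] : 𝔸ˣ) : 𝔸) - ((hol V x [l₂, l₁] : 𝔸ˣ) : 𝔸)‖ ≤ α := by
  rw [hol_pair_eq_square_mul x l₁ l₂, Units.val_mul]
  set W : 𝔸 := ((hol V x [l₁, l₂, l₁.rev, l₂.rev] : 𝔸ˣ) : 𝔸)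
  set T : 𝔸 := ((hol V x [l₂, l₁] : 𝔸ˣ) : 𝔸)
  have hT : ‖T‖ ≤ 1 := (mem_U1.1 (hol_mem hV x [l₂, l₁])).1
  have e : W * T - T = (W - 1) * T := by noncomm_ring
  rw [e]
  calc ‖(W - 1) * T‖ ≤ ‖W - 1‖ * ‖T‖ := norm_mul_le _ _
    _ ≤ α * 1 := mul_le_mul (norm_hol_square_sub_one_le hV h44 x l₁ l₂ h) hT (norm_nonneg _)
        ((norm_nonneg _).trans (norm_hol_square_sub_one_le hV h44 x l₁ l₂ h))
    _ = α := mul_one α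

omit [NormOneClass 𝔸] in
/-- **PARALLEL LETTERS COMMUTE EXACTLY**: `V(x; l₁ l₂) = V(x; l₂ l₁)` when `l₁ ∥ l₂` (equal letters, or a backtrack both ways). [folklore] -/
theorem hol_swap_of_parallel (x : Site d) (l₁ l₂ : Letter d) (h : l₁.1 = l₂.1) : hol V x [l₁, l₂] = hol V x [l₂, l₁] := by
  obtain ⟨κ, s⟩ := l₁
  obtain ⟨μ, t⟩ := l₂
  simp only at h
  subst h
  cases s <;> cases t
  · rfl
  · have h1 := hol_backtrack V x [] [] ((κ, false) : Letter d)
    have h2 := hol_backtrack V x [] [] ((κ, true) : Letter d)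
    simp only [List.nil_append, Letter.rev_mk, Bool.not_false, Bool.not_true] at h1 h2
    rw [h1, h2]
  · have h1 := hol_backtrack V x [] [] ((κ, true) : Letter d)
    have h2 := hol_backtrack V x [] [] ((κ, false) : Letter d)
    simp only [List.nil_append, Letter.rev_mk, Bool.not_false, Bool.not_true] at h1 h2
    rw [h1, h2]
  · rfl

end Swap

/-! ## §3 Carrying one letter past a word -/

section Carry

include hV h44 in
/-- **CARRYING ONE LETTER PAST A WORD**: `‖V(x; l A) − V(x; A l)‖ ≤ |A|·α` (`0 ≤ α`; parallel letters of `A` cost nothing, the others one square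
each). [folklore] -/
theorem norm_hol_cons_sub_append_le (hα : 0 ≤ α) (l : Letter d) : ∀ (A : List (Letter d)) (x : Site d),
    ‖((hol V x (l :: A) : 𝔸ˣ) : 𝔸) - ((hol V x (A ++ [l]) : 𝔸ˣ) : 𝔸)‖ ≤ A.length * α
  | [], x => by simp
  | a :: A, x => by
    have ih := norm_hol_cons_sub_append_le hα l A (x + a.vec)
    -- step 1: swap `l a ↦ a l` at the front
    have hswap : ‖((hol V x [l, a] : 𝔸ˣ) : 𝔸) - ((hol V x [a, l] : 𝔸ˣ) : 𝔸)‖ ≤ α := by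
      by_cases h : l.1 = a.1
      · rw [hol_swap_of_parallel x l a h, sub_self, norm_zero]; exact hα
      · exact norm_hol_swap_sub_le hV h44 x l a h
    have hsplit1 : hol V x (l :: a :: A) = hol V x [l, a] * hol V (x + l.vec + a.vec) A := by
      rw [show l :: a :: A = [l, a] ++ A from rfl, hol_append]; simp [add_assoc]
    have hsplit2 : hol V x (a :: l :: A) = hol V x [a, l] * hol V (x + l.vec + a.vec) A := by
      rw [show a :: l :: A = [a, l] ++ A from rfl, hol_append]
      simp only [disp_cons, disp_nil, add_zero]
      rw [show x + (a.vec + l.vec) = x + l.vec + a.vec by abel]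
    have hT : ‖((hol V (x + l.vec + a.vec) A : 𝔸ˣ) : 𝔸)‖ ≤ 1 := (mem_U1.1 (hol_mem hV _ _)).1
    have h1 : ‖((hol V x (l :: a :: A) : 𝔸ˣ) : 𝔸) - ((hol V x (a :: l :: A) : 𝔸ˣ) : 𝔸)‖ ≤ α := by
      rw [hsplit1, hsplit2, Units.val_mul, Units.val_mul, ← sub_mul]
      calc _ ≤ ‖((hol V x [l, a] : 𝔸ˣ) : 𝔸) - ((hol V x [a, l] : 𝔸ˣ) : 𝔸)‖ * ‖((hol V (x + l.vec + a.vec) A : 𝔸ˣ) : 𝔸)‖ :=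
            norm_mul_le _ _
        _ ≤ α * 1 := mul_le_mul hswap hT (norm_nonneg _) hα
        _ = α := mul_one α
    -- step 2: carry `l` past the rest, behind the unit-bounded factor `V(x; a)`
    have hs : ‖((stepHol V x a : 𝔸ˣ) : 𝔸)‖ ≤ 1 := (mem_U1.1 (stepHol_mem hV x a)).1
    have h2 : ‖((hol V x (a :: l :: A) : 𝔸ˣ) : 𝔸) - ((hol V x (a :: (A ++ [l])) : 𝔸ˣ) : 𝔸)‖ ≤ A.length * α := by
      rw [hol_cons V x a (l :: A), hol_cons V x a (A ++ [l]), Units.val_mul, Units.val_mul, ← mul_sub]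
      calc _ ≤ ‖((stepHol V x a : 𝔸ˣ) : 𝔸)‖ * ‖((hol V (x + a.vec) (l :: A) : 𝔸ˣ) : 𝔸) - ((hol V (x + a.vec) (A ++ [l]) : 𝔸ˣ) : 𝔸)‖ :=
            norm_mul_le _ _
        _ ≤ 1 * (A.length * α) := mul_le_mul hs ih (norm_nonneg _) zero_le_one
        _ = A.length * α := one_mul _
    calc ‖((hol V x (l :: a :: A) : 𝔸ˣ) : 𝔸) - ((hol V x (a :: A ++ [l]) : 𝔸ˣ) : 𝔸)‖
        ≤ ‖((hol V x (l :: a :: A) : 𝔸ˣ) : 𝔸) - ((hol V x (a :: l :: A) : 𝔸ˣ) : 𝔸)‖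
          + ‖((hol V x (a :: l :: A) : 𝔸ˣ) : 𝔸) - ((hol V x (a :: (A ++ [l])) : 𝔸ˣ) : 𝔸)‖ := norm_sub_le_norm_sub_add_norm_sub _ _ _
      _ ≤ α + A.length * α := add_le_add h1 h2
      _ = (a :: A).length * α := by rw [List.length_cons]; push_cast; ring

end Carry

/-! ## §4 Carrying a word past a word -/

section Comm

include hV h44 in
/-- **TWO PATHS WITH THE SAME LETTERS**: `‖V(x; Γ S) − V(x; S Γ)‖ ≤ |Γ|·|S|·α` (`0 ≤ α`). [folklore] -/
theorem norm_hol_comm_sub_le (hα : 0 ≤ α) (S : List (Letter d)) : ∀ (Γ : List (Letter d)) (x : Site d),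
    ‖((hol V x (Γ ++ S) : 𝔸ˣ) : 𝔸) - ((hol V x (S ++ Γ) : 𝔸ˣ) : 𝔸)‖ ≤ Γ.length * S.length * α
  | [], x => by simp
  | γ :: Γ, x => by
    have ih := norm_hol_comm_sub_le hα S Γ (x + γ.vec)
    -- step 1: behind `V(x; γ)`, commute `Γ` past `S`
    have hs : ‖((stepHol V x γ : 𝔸ˣ) : 𝔸)‖ ≤ 1 := (mem_U1.1 (stepHol_mem hV x γ)).1
    have h1 : ‖((hol V x (γ :: (Γ ++ S)) : 𝔸ˣ) : 𝔸) - ((hol V x (γ :: (S ++ Γ)) : 𝔸ˣ) : 𝔸)‖ ≤ Γ.length * S.length * α := by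
      rw [hol_cons V x γ (Γ ++ S), hol_cons V x γ (S ++ Γ), Units.val_mul, Units.val_mul, ← mul_sub]
      calc _ ≤ ‖((stepHol V x γ : 𝔸ˣ) : 𝔸)‖ * ‖((hol V (x + γ.vec) (Γ ++ S) : 𝔸ˣ) : 𝔸) - ((hol V (x + γ.vec) (S ++ Γ) : 𝔸ˣ) : 𝔸)‖ :=
            norm_mul_le _ _
        _ ≤ 1 * (Γ.length * S.length * α) := mul_le_mul hs ih (norm_nonneg _) zero_le_one
        _ = Γ.length * S.length * α := one_mul _
    -- step 2: carry `γ` past `S`, in front of the unit-bounded tail `V(·; Γ)`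
    have hT : ‖((hol V (x + γ.vec + disp S) Γ : 𝔸ˣ) : 𝔸)‖ ≤ 1 := (mem_U1.1 (hol_mem hV _ _)).1
    have hsplit1 : hol V x (γ :: (S ++ Γ)) = hol V x (γ :: S) * hol V (x + γ.vec + disp S) Γ := by
      rw [show γ :: (S ++ Γ) = (γ :: S) ++ Γ from rfl, hol_append, disp_cons, add_assoc]
    have hsplit2 : hol V x (S ++ γ :: Γ) = hol V x (S ++ [γ]) * hol V (x + γ.vec + disp S) Γ := by
      rw [show S ++ γ :: Γ = (S ++ [γ]) ++ Γ by simp, hol_append, disp_append, disp_cons, disp_nil, add_zero,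
        show x + (disp S + γ.vec) = x + γ.vec + disp S by abel]
    have h2 : ‖((hol V x (γ :: (S ++ Γ)) : 𝔸ˣ) : 𝔸) - ((hol V x (S ++ γ :: Γ) : 𝔸ˣ) : 𝔸)‖ ≤ S.length * α := by
      rw [hsplit1, hsplit2, Units.val_mul, Units.val_mul, ← sub_mul]
      calc _ ≤ ‖((hol V x (γ :: S) : 𝔸ˣ) : 𝔸) - ((hol V x (S ++ [γ]) : 𝔸ˣ) : 𝔸)‖ * ‖((hol V (x + γ.vec + disp S) Γ : 𝔸ˣ) : 𝔸)‖ :=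
            norm_mul_le _ _
        _ ≤ S.length * α * 1 := mul_le_mul (norm_hol_cons_sub_append_le hV h44 hα γ S x) hT (norm_nonneg _)
            (mul_nonneg (Nat.cast_nonneg _) hα)
        _ = S.length * α := mul_one _
    calc ‖((hol V x (γ :: Γ ++ S) : 𝔸ˣ) : 𝔸) - ((hol V x (S ++ γ :: Γ) : 𝔸ˣ) : 𝔸)‖
        ≤ ‖((hol V x (γ :: (Γ ++ S)) : 𝔸ˣ) : 𝔸) - ((hol V x (γ :: (S ++ Γ)) : 𝔸ˣ) : 𝔸)‖
          + ‖((hol V x (γ :: (S ++ Γ)) : 𝔸ˣ) : 𝔸) - ((hol V x (S ++ γ :: Γ) : 𝔸ˣ) : 𝔸)‖ := norm_sub_le_norm_sub_add_norm_sub _ _ _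
      _ ≤ Γ.length * S.length * α + S.length * α := add_le_add h1 h2
      _ = (γ :: Γ).length * S.length * α := by rw [List.length_cons]; push_cast; ring

end Comm

/-! ## §5 The cell's letter: tree contour then segment, against segment then translated contour -/

section Cell

include hV h44 in
/-- **THE CELL'S PAIR**: `‖V(x; treeWord r · seg κ L) − V(x; seg κ L · treeWord r)‖ ≤ l1(r)·L·α`. [folklore] -/
theorem norm_hol_treeWord_seg_sub_le (hα : 0 ≤ α) (x r : Site d) (κ : Fin d) (L : ℕ) :
    ‖((hol V x (treeWord r ++ seg κ L) : 𝔸ˣ) : 𝔸) - ((hol V x (seg κ L ++ treeWord r) : 𝔸ˣ) : 𝔸)‖ ≤ l1 r * L * α := by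
  have h := norm_hol_comm_sub_le hV h44 hα (seg κ L) (treeWord r) x
  rwa [length_treeWord, length_seg, Int.natAbs_natCast] at h

include hV h44 in
/-- **THE BLOCK-LOOP LETTER `w₁` BY VALUE** — VERBATIM the `hW` hypothesis of `OneStepLoopLetters.delta2_le`: with `g = V(q; treeWord r)`,
`t₁ = V(q + r; seg κ L)`, `g′ = V(q + Le_κ; treeWord r)`, `s₁ = V(q; seg κ L)`: `‖g t₁ g′⁻¹ s₁⁻¹ − 1‖ ≤ l1(r)·L·α` — NO smallness condition on `α`. [folklore] -/
theorem norm_W1_sub_one_le (hα : 0 ≤ α) (q r : Site d) (κ : Fin d) (L : ℕ) :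
    ‖(((hol V q (treeWord r) * hol V (q + r) (seg κ L) * (hol V (q + (L : ℤ) • e κ) (treeWord r))⁻¹ * (hol V q (seg κ L))⁻¹ : 𝔸ˣ)) : 𝔸)
        - 1‖ ≤ l1 r * L * α := by
  set g := hol V q (treeWord r)
  set t₁ := hol V (q + r) (seg κ L)
  set g' := hol V (q + (L : ℤ) • e κ) (treeWord r)
  set s₁ := hol V q (seg κ L)
  have hP : hol V q (treeWord r ++ seg κ L) = g * t₁ := by rw [hol_append, disp_treeWord]
  have hQ : hol V q (seg κ L ++ treeWord r) = s₁ * g' := by rw [hol_append, disp_seg]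
  have hcomm := norm_hol_treeWord_seg_sub_le hV h44 hα q r κ L
  rw [hP, hQ, Units.val_mul, Units.val_mul] at hcomm
  have hg' : ‖((g'⁻¹ : 𝔸ˣ) : 𝔸)‖ ≤ 1 := (mem_U1.1 (hol_mem hV _ _)).2
  have hs₁ : ‖((s₁⁻¹ : 𝔸ˣ) : 𝔸)‖ ≤ 1 := (mem_U1.1 (hol_mem hV _ _)).2
  have e1 : (((g * t₁ * g'⁻¹ * s₁⁻¹ : 𝔸ˣ)) : 𝔸) - 1 =
      ((g : 𝔸) * (t₁ : 𝔸) - (s₁ : 𝔸) * (g' : 𝔸)) * (((g'⁻¹ : 𝔸ˣ) : 𝔸) * ((s₁⁻¹ : 𝔸ˣ) : 𝔸)) := by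
    have hsg : (s₁ : 𝔸) * (g' : 𝔸) * (((g'⁻¹ : 𝔸ˣ) : 𝔸) * ((s₁⁻¹ : 𝔸ˣ) : 𝔸)) = 1 := by
      rw [← mul_assoc, mul_assoc (s₁ : 𝔸), Units.mul_inv, mul_one, Units.mul_inv]
    simp only [Units.val_mul, sub_mul, hsg, mul_assoc]
  rw [e1]
  calc _ ≤ ‖(g : 𝔸) * (t₁ : 𝔸) - (s₁ : 𝔸) * (g' : 𝔸)‖ * ‖((g'⁻¹ : 𝔸ˣ) : 𝔸) * ((s₁⁻¹ : 𝔸ˣ) : 𝔸)‖ := norm_mul_le _ _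
    _ ≤ (l1 r * L * α) * 1 := by
        refine mul_le_mul hcomm ((norm_mul_le _ _).trans ?_) (norm_nonneg _) ?_
        · calc ‖((g'⁻¹ : 𝔸ˣ) : 𝔸)‖ * ‖((s₁⁻¹ : 𝔸ˣ) : 𝔸)‖ ≤ 1 * 1 := mul_le_mul hg' hs₁ (norm_nonneg _) zero_le_one
            _ = 1 := mul_one 1
        · exact mul_nonneg (mul_nonneg (Nat.cast_nonneg _) (Nat.cast_nonneg _)) hα
    _ = l1 r * L * α := mul_one _

include hV h44 in
/-- … for a block point `r = boxVec L ρ`: `‖W₁ − 1‖ ≤ d·L²·α` (`l1 (boxVec L ρ) ≤ d·L`). [folklore] -/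
theorem norm_W1_sub_one_le_box (hα : 0 ≤ α) (q : Site d) (L : ℕ) (ρ : Fin d → Fin L) (κ : Fin d) :
    ‖(((hol V q (treeWord (boxVec L ρ)) * hol V (q + boxVec L ρ) (seg κ L) * (hol V (q + (L : ℤ) • e κ) (treeWord (boxVec L ρ)))⁻¹
        * (hol V q (seg κ L))⁻¹ : 𝔸ˣ)) : 𝔸) - 1‖ ≤ d * (L : ℝ) ^ 2 * α := by
  refine (norm_W1_sub_one_le hV h44 hα q (boxVec L ρ) κ L).trans ?_
  have hl : (l1 (boxVec L ρ) : ℝ) ≤ d * L := by exact_mod_cast l1_boxVec_le L ρ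
  have hL : (0 : ℝ) ≤ L := Nat.cast_nonneg _
  calc (l1 (boxVec L ρ) : ℝ) * L * α ≤ (d * L) * L * α := by gcongr
    _ = d * (L : ℝ) ^ 2 * α := by ring

end Cell

/-! ## §6 Toy -/

/-- Sanity: for `a ≠ b`, `‖V(x; a⁺b⁺) − V(x; b⁺a⁺)‖ ≤ α` is §2 at the positive letters (the square is `∂p_{ab}(x)` itself). -/
example (x : Site d) (a b : Fin d) (hab : a ≠ b) :
    ‖((hol V x [((a, true) : Letter d), (b, true)] : 𝔸ˣ) : 𝔸) - ((hol V x [((b, true) : Letter d), (a, true)] : 𝔸ˣ) : 𝔸)‖ ≤ α :=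
  norm_hol_swap_sub_le hV h44 x (a, true) (b, true) hab

end Summit.QuantumFields.BalabanUV.T4Continuum.NE7b.PathPairUnitBall
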